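import Literature.Probability.LatticeModels.SixVertexSpectralMeasureConvergence
import Literature.Probability.LatticeModels.SixVertexSpectralIntegrands
import Literature.Analysis.SpecialFunctions.OneSubMulPowUniform
import Mathlib.Analysis.SpecialFunctions.Trigonometric.Bounds
import Mathlib.MeasureTheory.Integral.DominatedConvergence
import Mathlib.Analysis.SpecificLimits.Basic

/-!
# Scaling limit of the truncated discrete spectral integrand (DKLM 2026, Part II, Lemma 34, Step 2)

H. Duminil-Copin, K. K. Kozlowski, P. Lammers, I. Manolescu, *Gaussian free field convergence of
the six-vertex model with `-1 ≤ Δ ≤ -1/2`*, arXiv:2603.06268 (2026) [DKLM2026SixVertexGFF]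
(`paper:arxiv-2603.06268`, chunks p0024–p0025):

> For `u = (x,y) ∈ ℝ²`, set `u/δ := (⌊x/δ⌋, ⌊y/δ⌋) ∈ ℤ²` […].
> **Lemma 34** […] Step 2: `P_n = ∫ f_n(a,b) dμ_∞^{(δ_n)}(a,b)`, where
> `f_n(a,b) := 𝟙{a ≤ 1/δ_n} · χ^discr_{u/δ_n}(δ_n a, δ_n b)`. By working out an explicit expression
> for `f_n`, it is straightforward to see that `f_n` converges on every compact subset of
> `ℝ_{>0} × ℝ` to `χ_u` as `n` tends to infinity. Also, the fact that `{y₁, y₂} ∋ 0` implies that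
> `sup_{n,a,b} (a ∨ 1/a)|f_n(a,b)| < ∞`. Since `μ_∞^{(δ_n)}` tends to `μ` (by hypothesis), the
> convergence of `P_n` now follows from Lemma 31.

We carry this out for abstract lattice data: integer displacements `kx_i(n) ∈ ℕ`, `ky_i(n) ∈ ℤ`
with `δ_n kx_i(n) → x_i`, `δ_n ky_i(n) → y_i` (as produced by `u/δ_n`, `scaled_floor_sub_tendsto`),
and the truncated integrand realised continuously through the clamp `(1-a)⁺`
(`chiDiscrClamp`, `SixVertexSpectralIntegrands.lean`):
`fScaled n (a,b) := χ^discr,clamp_{kx,ky}(δ_n a, δ_n b)`.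

* `tendstoLocallyUniformlyOn_clampPow` (`((1 - δ_n a)⁺)^{k_n} → e^{-ax}`),
  `tendstoLocallyUniformlyOn_phase` (`e^{-i δ_n b ky_n} → e^{-iby}`);
* **`tendstoLocallyUniformlyOn_fScaled`** — `f_n → χ_u` locally uniformly on `ℝ²`;
* **`norm_fScaled_le`** — the domination `|f_n(a,b)| ≤ K (a ∧ 1/a)` on `ℝ_{>0} × ℝ` when
  `y₁ = 0` (i.e. `ky₁ = 0`), `x₁' > 0`, for `n` large;
* **`tendsto_integral_fScaled`** — Step 2 of the proof of Lemma 34: `∫ f_n dν_n → ∫ χ_u dμ`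
  along a convergence sequence (`ν_n → μ` vaguely in `𝓜_{c,C}`), by Lemma 31 (iii);
* **`tendsto_setIntegral_chiDiscr_Ioc_zero`** — Step 1 of the proof of Lemma 34:
  `N_n = ∫_{1<a≤2} χ^discr_{u(n)} dμ → 0` given `μ{a = 2} = 0` (the regularity input) and
  `x₁'(n) → ∞`.

## References

* H. Duminil-Copin, K. K. Kozlowski, P. Lammers, I. Manolescu, arXiv:2603.06268 (2026), Part II,
  §1.2.3 and Lemma 34 (proof, Step 2). [DKLM2026SixVertexGFF]
-/

noncomputable section

open MeasureTheory Set Filter Topology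
open Literature.Analysis.SpecialFunctions

namespace Literature.Probability.LatticeModels.SixVertex

/-! ## 1. Lattice data: `δ ⌊p/δ⌋ - δ ⌊q/δ⌋ → p - q` -/

/-- The displacement of lattice approximations converges: `δ(⌊p/δ⌋ - ⌊q/δ⌋) → p - q` as `δ → 0⁺`.
[cite: DKLM2026SixVertexGFF, Part II §1.2.3 (`u/δ`)] -/
theorem scaled_floor_sub_tendsto {δ : ℕ → ℝ} (hδ0 : ∀ n, 0 < δ n) (hδ : Tendsto δ atTop (𝓝 0)) (p q : ℝ) :
    Tendsto (fun n => δ n * ((⌊p / δ n⌋ - ⌊q / δ n⌋ : ℤ) : ℝ)) atTop (𝓝 (p - q)) := by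
  -- `|δ⌊t/δ⌋ - t| ≤ δ`
  have hb : ∀ n (t : ℝ), |δ n * ⌊t / δ n⌋ - t| ≤ δ n := by
    intro n t
    have h1 := Int.floor_le (t / δ n)
    have h2 := Int.lt_floor_add_one (t / δ n)
    have e : δ n * (t / δ n) = t := by rw [mul_div_assoc']; exact mul_div_cancel_left₀ t (hδ0 n).ne'
    rw [abs_le]
    constructor <;> nlinarith [hδ0 n]
  rw [Metric.tendsto_atTop]
  intro ε hε
  obtain ⟨N, hN⟩ := Metric.tendsto_atTop.1 hδ (ε / 2) (by positivity)
  refine ⟨N, fun n hn => ?_⟩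
  have hδn : δ n < ε / 2 := by simpa [abs_of_pos (hδ0 n)] using hN n hn
  rw [dist_eq_norm, Real.norm_eq_abs]
  push_cast
  calc |δ n * (⌊p / δ n⌋ - ⌊q / δ n⌋) - (p - q)| = |(δ n * ⌊p / δ n⌋ - p) - (δ n * ⌊q / δ n⌋ - q)| := by ring_nf
    _ ≤ |δ n * ⌊p / δ n⌋ - p| + |δ n * ⌊q / δ n⌋ - q| := abs_sub _ _
    _ ≤ δ n + δ n := add_le_add (hb n p) (hb n q)
    _ < ε := by linarith

/-! ## 2. The two elementary locally uniform limits -/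

/-- Every compact subset of `ℝ²` lies in a square `[-β, β]²`. [folklore] -/
theorem exists_square_of_isCompact {K : Set (ℝ × ℝ)} (hK : IsCompact K) :
    ∃ β : ℝ, 0 < β ∧ K ⊆ Icc (-β) β ×ˢ Icc (-β) β := by
  obtain ⟨r, hr⟩ := hK.isBounded.subset_closedBall 0
  refine ⟨max r 1, lt_max_of_lt_right one_pos, fun p hp => ?_⟩
  have h := hr hp
  rw [Metric.mem_closedBall, dist_zero_right, Prod.norm_def, max_le_iff, Real.norm_eq_abs, Real.norm_eq_abs] at h
  have h1 := abs_le.1 (h.1.trans (le_max_left r 1))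
  have h2 := abs_le.1 (h.2.trans (le_max_left r 1))
  exact ⟨⟨h1.1, h1.2⟩, ⟨h2.1, h2.2⟩⟩

/-- `|e^{iθ} - e^{iθ'}| ≤ |θ - θ'|`. [folklore] -/
theorem norm_cexp_I_mul_sub_le (θ θ' : ℝ) :
    ‖Complex.exp (Complex.I * θ) - Complex.exp (Complex.I * θ')‖ ≤ |θ - θ'| := by
  have h : Complex.exp (Complex.I * θ) - Complex.exp (Complex.I * θ') =
      Complex.exp (Complex.I * θ') * (Complex.exp (Complex.I * ((θ - θ' : ℝ) : ℂ)) - 1) := by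
    rw [mul_sub, mul_one, ← Complex.exp_add]
    push_cast
    ring_nf
  rw [h, norm_mul, mul_comm Complex.I (θ' : ℂ), Complex.norm_exp_ofReal_mul_I, one_mul]
  exact (Real.norm_exp_I_mul_ofReal_sub_one_le).trans (le_of_eq (Real.norm_eq_abs _))

section Limits

variable {δ : ℕ → ℝ} (hδ0 : ∀ n, 0 < δ n) (hδ : Tendsto δ atTop (𝓝 0))

include hδ0 hδ

/-- **`((1 - δ_n a)⁺)^{k_n} → e^{-ax}` locally uniformly on `ℝ²`** when `δ_n k_n → x`.
[cite: DKLM2026SixVertexGFF, Part II, proof of Lemma 34, Step 2] -/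
theorem tendstoLocallyUniformlyOn_clampPow {k : ℕ → ℕ} {x : ℝ} (hk : Tendsto (fun n => δ n * k n) atTop (𝓝 x)) :
    TendstoLocallyUniformlyOn (fun n (p : ℝ × ℝ) => clampOneSub (δ n * p.1) ^ k n)
      (fun p => ((Real.exp (-(p.1 * x)) : ℝ) : ℂ)) atTop univ := by
  rw [tendstoLocallyUniformlyOn_iff_forall_isCompact isOpen_univ]
  intro K _ hK
  obtain ⟨β, hβ, hKβ⟩ := exists_square_of_isCompact hK
  have hR := tendstoUniformlyOn_one_sub_mul_pow (Eventually.of_forall hδ0) hδ hk hβ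
  have hC := Complex.isometry_ofReal.uniformContinuous.comp_tendstoUniformlyOn (hR.comp (Prod.fst : ℝ × ℝ → ℝ))
  -- eventually `δ β < 1`, so the clamp is invisible on the square
  have hev : ∀ᶠ n in atTop, δ n * β < 1 := by
    have := hδ.eventually (gt_mem_nhds (show (0 : ℝ) < 1 / β by positivity))
    filter_upwards [this] with n hn
    rwa [lt_div_iff₀ hβ] at hn
  refine ((hC.congr ?_).mono fun p hp => (hKβ hp).1)
  filter_upwards [hev] with n hn p hp
  simp only [Function.comp_apply, mem_preimage] at hp ⊢
  have hle : δ n * p.1 ≤ 1 := by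
    have : δ n * p.1 ≤ δ n * β := by have := hp.2; nlinarith [hδ0 n]
    linarith
  rw [clampOneSub_of_le hle]
  push_cast
  ring

omit hδ0 hδ in
/-- **`e^{-i δ_n b ky_n} → e^{-iby}` locally uniformly on `ℝ²`** when `δ_n ky_n → y`.
[cite: DKLM2026SixVertexGFF, Part II, proof of Lemma 34, Step 2] -/
theorem tendstoLocallyUniformlyOn_phase {ky : ℕ → ℤ} {y : ℝ} (hky : Tendsto (fun n => δ n * ky n) atTop (𝓝 y)) :
    TendstoLocallyUniformlyOn (fun n (p : ℝ × ℝ) => Complex.exp (-(Complex.I * ((δ n * p.2 : ℝ) : ℂ) * (ky n : ℂ))))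
      (fun p => Complex.exp (-(Complex.I * (p.2 : ℂ) * (y : ℂ)))) atTop univ := by
  rw [tendstoLocallyUniformlyOn_iff_forall_isCompact isOpen_univ]
  intro K _ hK
  obtain ⟨β, hβ, hKβ⟩ := exists_square_of_isCompact hK
  rw [Metric.tendstoUniformlyOn_iff]
  intro ε hε
  have hev : ∀ᶠ n in atTop, |δ n * ky n - y| < ε / β := by
    have := (Metric.tendsto_nhds.1 hky) _ (by positivity : (0 : ℝ) < ε / β)
    simpa only [dist_eq_norm, Real.norm_eq_abs] using this
  filter_upwards [hev] with n hn p hp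
  have hb : |p.2| ≤ β := abs_le.2 ⟨(hKβ hp).2.1, (hKβ hp).2.2⟩
  rw [dist_eq_norm, ← norm_neg, neg_sub]
  have e1 : -(Complex.I * ((δ n * p.2 : ℝ) : ℂ) * (ky n : ℂ)) = Complex.I * ((-(p.2 * (δ n * ky n)) : ℝ) : ℂ) := by
    push_cast; ring
  have e2 : -(Complex.I * (p.2 : ℂ) * (y : ℂ)) = Complex.I * ((-(p.2 * y) : ℝ) : ℂ) := by push_cast; ring
  rw [e1, e2]
  calc ‖Complex.exp (Complex.I * ((-(p.2 * (δ n * ky n)) : ℝ) : ℂ)) - Complex.exp (Complex.I * ((-(p.2 * y) : ℝ) : ℂ))‖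
      ≤ |-(p.2 * (δ n * ky n)) - -(p.2 * y)| := norm_cexp_I_mul_sub_le _ _
    _ = |p.2| * |δ n * ky n - y| := by
        rw [show -(p.2 * (δ n * ky n)) - -(p.2 * y) = -(p.2 * (δ n * ky n - y)) by ring, abs_neg, abs_mul]
    _ ≤ β * |δ n * ky n - y| := by gcongr
    _ < β * (ε / β) := by gcongr
    _ = ε := mul_div_cancel₀ _ hβ.ne'

end Limits

/-! ## 3. The scaled truncated integrand and its locally uniform limit -/

section Scaled

variable (δ : ℕ → ℝ) (kx₁ : ℕ → ℕ) (ky₁ : ℕ → ℤ) (kx₁' : ℕ → ℕ) (ky₁' : ℕ → ℤ) (kx₂ : ℕ → ℕ) (ky₂ : ℕ → ℤ)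

/-- **`f_n(a,b) := χ^discr,clamp_{u/δ_n}(δ_n a, δ_n b)`** (`= 𝟙{a ≤ 1/δ_n} χ^discr_{u/δ_n}(δ_n a, δ_n b)`
when `x₁'(n) ≥ 1`). [cite: DKLM2026SixVertexGFF, Part II, proof of Lemma 34, Step 2] -/
def fScaled (n : ℕ) (p : ℝ × ℝ) : ℂ :=
  chiDiscrClamp (kx₁ n) (ky₁ n) (kx₁' n) (ky₁' n) (kx₂ n) (ky₂ n) (δ n * p.1, δ n * p.2)

/-- `f_n` is continuous. [cite: DKLM2026SixVertexGFF, Part II, proof of Lemma 34, Step 2] -/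
theorem continuous_fScaled (n : ℕ) : Continuous (fScaled δ kx₁ ky₁ kx₁' ky₁' kx₂ ky₂ n) := by
  unfold fScaled
  exact (continuous_chiDiscrClamp _ _ _ _ _ _).comp (by fun_prop)

/-- `f_n` is the truncated integrand `𝟙{a ≤ 1/δ_n} χ^discr_{u/δ_n}(δ_n a, δ_n b)` when `x₁'(n) ≥ 1`.
[cite: DKLM2026SixVertexGFF, Part II, proof of Lemma 34, Step 2] -/
theorem fScaled_eq_indicator {n : ℕ} (hδ : 0 < δ n) (hx : 1 ≤ kx₁' n) (p : ℝ × ℝ) :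
    fScaled δ kx₁ ky₁ kx₁' ky₁' kx₂ ky₂ n p =
      Set.indicator {p : ℝ × ℝ | p.1 ≤ (δ n)⁻¹} (fun p => chiDiscr (kx₁ n) (ky₁ n) (kx₁' n) (ky₁' n) (kx₂ n) (ky₂ n)
        (δ n * p.1, δ n * p.2)) p := by
  rw [fScaled, ← indicator_chiDiscr_eq_chiDiscrClamp _ _ hx]
  by_cases hp : p.1 ≤ (δ n)⁻¹
  · rw [indicator_of_mem (show p ∈ {p : ℝ × ℝ | p.1 ≤ (δ n)⁻¹} from hp),
      indicator_of_mem (show (δ n * p.1, δ n * p.2) ∈ {p : ℝ × ℝ | p.1 ≤ 1} from ?_)]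
    show δ n * p.1 ≤ 1
    rwa [← le_div_iff₀' hδ, one_div]
  · rw [indicator_of_notMem (show p ∉ {p : ℝ × ℝ | p.1 ≤ (δ n)⁻¹} from hp),
      indicator_of_notMem (show (δ n * p.1, δ n * p.2) ∉ {p : ℝ × ℝ | p.1 ≤ 1} from ?_)]
    show ¬(δ n * p.1 ≤ 1)
    rwa [← le_div_iff₀' hδ, one_div]

variable {δ kx₁ ky₁ kx₁' ky₁' kx₂ ky₂}
variable (hδ0 : ∀ n, 0 < δ n) (hδ : Tendsto δ atTop (𝓝 0)) {x₁ y₁ x₁' y₁' x₂ y₂ : ℝ}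
  (hx₁ : Tendsto (fun n => δ n * kx₁ n) atTop (𝓝 x₁)) (hy₁ : Tendsto (fun n => δ n * ky₁ n) atTop (𝓝 y₁))
  (hx₁' : Tendsto (fun n => δ n * kx₁' n) atTop (𝓝 x₁')) (hy₁' : Tendsto (fun n => δ n * ky₁' n) atTop (𝓝 y₁'))
  (hx₂ : Tendsto (fun n => δ n * kx₂ n) atTop (𝓝 x₂)) (hy₂ : Tendsto (fun n => δ n * ky₂ n) atTop (𝓝 y₂))

include hδ0 hδ hx₁ hy₁ hx₁' hy₁' hx₂ hy₂

/-- **`f_n → χ_u` locally uniformly on `ℝ²`** ("by working out an explicit expression for `f_n`").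
[cite: DKLM2026SixVertexGFF, Part II, proof of Lemma 34, Step 2] -/
theorem tendstoLocallyUniformlyOn_fScaled :
    TendstoLocallyUniformlyOn (fScaled δ kx₁ ky₁ kx₁' ky₁' kx₂ ky₂) (chiCont x₁ y₁ x₁' y₁' x₂ y₂) atTop univ := by
  have P₁ := tendstoLocallyUniformlyOn_clampPow hδ0 hδ hx₁
  have P₁' := tendstoLocallyUniformlyOn_clampPow hδ0 hδ hx₁'
  have P₂ := tendstoLocallyUniformlyOn_clampPow hδ0 hδ hx₂
  have E₁ := tendstoLocallyUniformlyOn_phase hy₁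
  have E₁' := tendstoLocallyUniformlyOn_phase hy₁'
  have E₂ := tendstoLocallyUniformlyOn_phase hy₂
  have cP : ∀ x : ℝ, ContinuousOn (fun p : ℝ × ℝ => ((Real.exp (-(p.1 * x)) : ℝ) : ℂ)) univ := fun x =>
    Continuous.continuousOn (by fun_prop)
  have cE : ∀ y : ℝ, ContinuousOn (fun p : ℝ × ℝ => Complex.exp (-(Complex.I * (p.2 : ℂ) * (y : ℂ)))) univ := fun y =>
    Continuous.continuousOn (by fun_prop)
  have c1 : ContinuousOn (fun _ : ℝ × ℝ => (1 : ℂ)) univ := continuousOn_const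
  have one : TendstoLocallyUniformlyOn (fun (_ : ℕ) (_ : ℝ × ℝ) => (1 : ℂ)) (fun _ => (1 : ℂ)) atTop univ :=
    tendstoLocallyUniformlyOn_const_seq
  have T1 := ((P₂.mul₀ E₂ (cP x₂) (cE y₂)).sub one)
  have T2 := P₁'.mul₀ E₁' (cP x₁') (cE y₁')
  have T3 := one.sub (P₁.mul₀ E₁ (cP x₁) (cE y₁))
  have cT1 : ContinuousOn ((fun p : ℝ × ℝ => ((Real.exp (-(p.1 * x₂)) : ℝ) : ℂ)) *
      (fun p : ℝ × ℝ => Complex.exp (-(Complex.I * (p.2 : ℂ) * (y₂ : ℂ)))) - fun _ => (1 : ℂ)) univ :=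
    ((cP x₂).mul (cE y₂)).sub c1
  have cT2 : ContinuousOn ((fun p : ℝ × ℝ => ((Real.exp (-(p.1 * x₁')) : ℝ) : ℂ)) *
      fun p : ℝ × ℝ => Complex.exp (-(Complex.I * (p.2 : ℂ) * (y₁' : ℂ)))) univ := (cP x₁').mul (cE y₁')
  have cT3 : ContinuousOn ((fun _ => (1 : ℂ)) - (fun p : ℝ × ℝ => ((Real.exp (-(p.1 * x₁)) : ℝ) : ℂ)) *
      fun p : ℝ × ℝ => Complex.exp (-(Complex.I * (p.2 : ℂ) * (y₁ : ℂ)))) univ := c1.sub ((cP x₁).mul (cE y₁))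
  have T := (T1.mul₀ T2 cT1 cT2).mul₀ T3 (cT1.mul cT2) cT3
  refine (T.congr fun n p _ => ?_).congr_right fun p _ => ?_
  · simp only [Pi.mul_apply, Pi.sub_apply, fScaled, chiDiscrClamp]
  · simp only [Pi.mul_apply, Pi.sub_apply, chiCont]
    have e : ∀ x y : ℝ, ((Real.exp (-(p.1 * x)) : ℝ) : ℂ) * Complex.exp (-(Complex.I * (p.2 : ℂ) * (y : ℂ))) =
        Complex.exp (-((p.1 : ℂ) * x + Complex.I * p.2 * y)) := by
      intro x y
      rw [Complex.ofReal_exp, ← Complex.exp_add]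
      push_cast
      ring_nf
    rw [e, e, e]

end Scaled

/-! ## 4. Domination `|f_n| ≤ K (a ∧ 1/a)` when `y₁ = 0` -/

section Domination

variable (δ : ℕ → ℝ) (kx₁ : ℕ → ℕ) (ky₁ : ℕ → ℤ) (kx₁' : ℕ → ℕ) (ky₁' : ℕ → ℤ) (kx₂ : ℕ → ℕ) (ky₂ : ℕ → ℤ)

/-- Phases have modulus one. [folklore] -/
theorem norm_cexp_neg_I_mul_mul (r : ℝ) (m : ℤ) : ‖Complex.exp (-(Complex.I * (r : ℂ) * (m : ℂ)))‖ = 1 := by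
  rw [Complex.norm_exp]
  simp [Complex.mul_re, Complex.mul_im]

/-- `(1-t)^k ≤ e^{-tk}` for `t ≤ 1`. [folklore] -/
theorem one_sub_pow_le_exp_neg {t : ℝ} (ht1 : t ≤ 1) (k : ℕ) :
    (1 - t) ^ k ≤ Real.exp (-(t * k)) := by
  calc (1 - t) ^ k ≤ Real.exp (-t) ^ k := by
        refine pow_le_pow_left₀ (by linarith) ?_ k
        linarith [Real.add_one_le_exp (-t)]
    _ = Real.exp (-(t * k)) := by rw [← Real.exp_nat_mul]; ring_nf

/-- `1 - (1-t)^k ≤ kt` for `t ≤ 1` (Bernoulli). [folklore] -/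
theorem one_sub_one_sub_pow_le {t : ℝ} (ht1 : t ≤ 1) (k : ℕ) : 1 - (1 - t) ^ k ≤ k * t := by
  have h := one_add_mul_le_pow (show (-2 : ℝ) ≤ -t by linarith) k
  rw [show (1 : ℝ) + -t = 1 - t by ring] at h
  linarith

/-- `e^{-s} ≤ 1/s` for `s > 0`. [folklore] -/
theorem exp_neg_le_inv {s : ℝ} (hs : 0 < s) : Real.exp (-s) ≤ s⁻¹ := by
  rw [Real.exp_neg, inv_le_inv₀ (Real.exp_pos s) hs]
  linarith [Real.add_one_le_exp s]

/-- **Domination (`y₁ = 0`)**: if `ky₁(n) = 0`, `δ_n kx₁'(n) ≥ X₀ > 0` and `δ_n kx₁(n) ≤ X₁`, then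
`|f_n(a,b)| ≤ max(2X₁, 2/X₀) · (a ∧ 1/a)` on `ℝ_{>0} × ℝ` ("the fact that `{y₁,y₂} ∋ 0` implies
that `sup_{n,a,b} (a ∨ 1/a)|f_n(a,b)| < ∞`"). [cite: DKLM2026SixVertexGFF, Part II, proof of Lemma 34, Step 2] -/
theorem norm_fScaled_le {n : ℕ} (hδn : 0 < δ n) (hky₁ : ky₁ n = 0) {X₀ X₁ : ℝ} (hX₀ : 0 < X₀)
    (hX₀n : X₀ ≤ δ n * kx₁' n) (hX₁n : δ n * kx₁ n ≤ X₁) {p : ℝ × ℝ} (hp : 0 < p.1) :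
    ‖fScaled δ kx₁ ky₁ kx₁' ky₁' kx₂ ky₂ n p‖ ≤ max (2 * X₁) (2 / X₀) * min p.1 p.1⁻¹ := by
  have hkx₁' : 1 ≤ kx₁' n := by
    by_contra h0
    push Not at h0
    have : kx₁' n = 0 := by omega
    rw [this, Nat.cast_zero, mul_zero] at hX₀n
    linarith
  have hX₁ : 0 ≤ X₁ := le_trans (by positivity) hX₁n
  have hRHS : 0 ≤ max (2 * X₁) (2 / X₀) * min p.1 p.1⁻¹ := mul_nonneg (le_max_of_le_left (by positivity)) (min_inv_pos hp).le
  set t : ℝ := δ n * p.1 with ht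
  have ht0 : 0 < t := mul_pos hδn hp
  by_cases h1t : 1 ≤ t
  · rw [fScaled, chiDiscrClamp_of_ge _ _ hkx₁' _ _ _ (show 1 ≤ (δ n * p.1, δ n * p.2).1 from h1t), norm_zero]
    exact hRHS
  push Not at h1t
  -- `t < 1`: the clamp is `1 - t ∈ (0, 1]`
  have hc : clampOneSub t = ((1 - t : ℝ) : ℂ) := by rw [clampOneSub_of_le h1t.le]; push_cast; ring
  have hc0 : 0 ≤ 1 - t := by linarith
  have hc1 : 1 - t ≤ 1 := by linarith
  have hE₁ : Complex.exp (-(Complex.I * ((δ n * p.2 : ℝ) : ℂ) * ((ky₁ n : ℤ) : ℂ))) = 1 := by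
    rw [hky₁]; simp
  -- the three factors
  have f1 : ‖clampOneSub t ^ kx₂ n * Complex.exp (-(Complex.I * ((δ n * p.2 : ℝ) : ℂ) * ((ky₂ n : ℤ) : ℂ))) - 1‖ ≤ 2 := by
    refine (norm_sub_le _ _).trans ?_
    rw [norm_mul, norm_cexp_neg_I_mul_mul, mul_one, norm_one, hc, norm_pow, Complex.norm_real, Real.norm_eq_abs,
      abs_of_nonneg hc0]
    linarith [pow_le_one₀ hc0 hc1 (n := kx₂ n)]
  have f2 : ‖clampOneSub t ^ kx₁' n * Complex.exp (-(Complex.I * ((δ n * p.2 : ℝ) : ℂ) * ((ky₁' n : ℤ) : ℂ)))‖ =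
      (1 - t) ^ kx₁' n := by
    rw [norm_mul, norm_cexp_neg_I_mul_mul, mul_one, hc, norm_pow, Complex.norm_real, Real.norm_eq_abs, abs_of_nonneg hc0]
  have f3 : ‖(1 : ℂ) - clampOneSub t ^ kx₁ n * Complex.exp (-(Complex.I * ((δ n * p.2 : ℝ) : ℂ) * ((ky₁ n : ℤ) : ℂ)))‖ =
      1 - (1 - t) ^ kx₁ n := by
    rw [hE₁, mul_one, hc, ← Complex.ofReal_pow, ← Complex.ofReal_one, ← Complex.ofReal_sub, Complex.norm_real,
      Real.norm_eq_abs, abs_of_nonneg (by linarith [pow_le_one₀ hc0 hc1 (n := kx₁ n)])]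
  have hprod : ‖fScaled δ kx₁ ky₁ kx₁' ky₁' kx₂ ky₂ n p‖ ≤ 2 * (1 - t) ^ kx₁' n * (1 - (1 - t) ^ kx₁ n) := by
    rw [fScaled, chiDiscrClamp, norm_mul, norm_mul, f2, f3]
    gcongr
    linarith [pow_le_one₀ hc0 hc1 (n := kx₁ n)]
  -- two bounds
  have hA : ‖fScaled δ kx₁ ky₁ kx₁' ky₁' kx₂ ky₂ n p‖ ≤ 2 * X₁ * p.1 := by
    refine hprod.trans ?_
    calc 2 * (1 - t) ^ kx₁' n * (1 - (1 - t) ^ kx₁ n) ≤ 2 * 1 * (kx₁ n * t) := by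
          gcongr
          · linarith [pow_le_one₀ hc0 hc1 (n := kx₁ n)]
          · exact pow_le_one₀ hc0 hc1
          · exact one_sub_one_sub_pow_le h1t.le _
      _ = 2 * (δ n * kx₁ n) * p.1 := by rw [ht]; ring
      _ ≤ 2 * X₁ * p.1 := by gcongr
  have hB : ‖fScaled δ kx₁ ky₁ kx₁' ky₁' kx₂ ky₂ n p‖ ≤ 2 / X₀ * p.1⁻¹ := by
    refine hprod.trans ?_
    calc 2 * (1 - t) ^ kx₁' n * (1 - (1 - t) ^ kx₁ n) ≤ 2 * Real.exp (-(t * kx₁' n)) * 1 := by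
          gcongr
          · linarith [pow_le_one₀ hc0 hc1 (n := kx₁ n)]
          · exact one_sub_pow_le_exp_neg h1t.le _
          · linarith [pow_nonneg hc0 (kx₁ n)]
      _ ≤ 2 * Real.exp (-(p.1 * X₀)) * 1 := by
          have key : p.1 * X₀ ≤ t * kx₁' n :=
            calc p.1 * X₀ ≤ p.1 * (δ n * kx₁' n) := mul_le_mul_of_nonneg_left hX₀n hp.le
              _ = t * kx₁' n := by rw [ht]; ring
          exact mul_le_mul_of_nonneg_right
            (mul_le_mul_of_nonneg_left (Real.exp_le_exp.2 (neg_le_neg key)) zero_le_two) zero_le_one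
      _ ≤ 2 * (p.1 * X₀)⁻¹ * 1 := by gcongr; exact exp_neg_le_inv (by positivity)
      _ = 2 / X₀ * p.1⁻¹ := by rw [mul_inv]; field_simp
  -- combine
  rcases le_or_gt p.1 1 with hp1 | hp1
  · have hmin : min p.1 p.1⁻¹ = p.1 := min_eq_left (hp1.trans (one_le_inv_iff₀.2 ⟨hp, hp1⟩))
    rw [hmin]
    exact hA.trans (mul_le_mul_of_nonneg_right (le_max_left _ _) hp.le)
  · have hmin : min p.1 p.1⁻¹ = p.1⁻¹ := min_eq_right ((inv_le_one_of_one_le₀ hp1.le).trans hp1.le)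
    rw [hmin]
    exact hB.trans (mul_le_mul_of_nonneg_right (le_max_right _ _) (inv_nonneg.2 hp.le))

end Domination

/-! ## 5. Step 2 of the proof of Lemma 34: `∫ f_n dν_n → ∫ χ_u dμ` -/

section Step2

variable {c C : ℝ} {δ : ℕ → ℝ} {kx₁ : ℕ → ℕ} {ky₁ : ℕ → ℤ} {kx₁' : ℕ → ℕ} {ky₁' : ℕ → ℤ} {kx₂ : ℕ → ℕ}
  {ky₂ : ℕ → ℤ}

/-- **Lemma 34, proof, Step 2 (limit of `P_n`)**: along a sequence `ν_n → μ` converging vaguely in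
`𝓜_{c,C}` (e.g. `ν_n = μ_∞^{(δ_n)}` along a convergence sequence), for horizontally strictly
ordered lattice data with `y₁ = 0` (`ky₁ = 0`, `δ_n kx₁'(n) ≥ X₀ > 0`, `δ_n kx₁(n) ≤ X₁`) and
`δ_n kx_i(n) → x_i`, `δ_n ky_i(n) → y_i`:
`∫ f_n dν_n → ∫ χ_u dμ` (Lemma 31 (iii) with the domination `a ∧ 1/a`).
[cite: DKLM2026SixVertexGFF, Part II, Lemma 34 (proof, Step 2)] -/
theorem tendsto_integral_fScaled (hc : 0 < c) (hC : 0 ≤ C) {νs : ℕ → Measure (ℝ × ℝ)}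
    (hνs : ∀ n, νs n ∈ dklmSpaceM c C) {μ : Measure (ℝ × ℝ)} (hμ : μ ∈ dklmSpaceM c C)
    (hv : HalfPlaneVagueTendsto νs μ) (hδ0 : ∀ n, 0 < δ n) (hδ : Tendsto δ atTop (𝓝 0)) {x₁ x₁' y₁' x₂ y₂ : ℝ}
    (hx₁ : Tendsto (fun n => δ n * kx₁ n) atTop (𝓝 x₁)) (hky₁ : ∀ n, ky₁ n = 0)
    (hx₁' : Tendsto (fun n => δ n * kx₁' n) atTop (𝓝 x₁')) (hy₁' : Tendsto (fun n => δ n * ky₁' n) atTop (𝓝 y₁'))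
    (hx₂ : Tendsto (fun n => δ n * kx₂ n) atTop (𝓝 x₂)) (hy₂ : Tendsto (fun n => δ n * ky₂ n) atTop (𝓝 y₂))
    {X₀ X₁ : ℝ} (hX₀ : 0 < X₀) (hX₀n : ∀ n, X₀ ≤ δ n * kx₁' n) (hX₁n : ∀ n, δ n * kx₁ n ≤ X₁) :
    Tendsto (fun n => ∫ p, fScaled δ kx₁ ky₁ kx₁' ky₁' kx₂ ky₂ n p ∂νs n) atTop
      (𝓝 (∫ p, chiCont x₁ 0 x₁' y₁' x₂ y₂ p ∂μ)) := by
  have hy₁ : Tendsto (fun n => δ n * (ky₁ n : ℝ)) atTop (𝓝 0) := by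
    simp only [hky₁, Int.cast_zero, mul_zero]
    exact tendsto_const_nhds
  exact dklmSpaceM_tendsto_integral hc hC hνs hμ hv
    (fun n => (continuous_fScaled δ kx₁ ky₁ kx₁' ky₁' kx₂ ky₂ n).continuousOn)
    (fun n p hp => norm_fScaled_le δ kx₁ ky₁ kx₁' ky₁' kx₂ ky₂ (hδ0 n) (hky₁ n) hX₀ (hX₀n n) (hX₁n n) hp)
    ((tendstoLocallyUniformlyOn_fScaled hδ0 hδ hx₁ hy₁ hx₁' hy₁' hx₂ hy₂).mono (subset_univ _))

end Step2

/-! ## 6. Step 1 of the proof of Lemma 34: the negative eigenvalues do not contribute -/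

section Step1

/-- `|χ^discr_u(a,b)| ≤ 4 |1-a|^{x₁'}` for `|1 - a| ≤ 1`, i.e. `0 ≤ a ≤ 2` ("by writing out
`χ^discr_{u/δ_n}` explicitly"). [cite: DKLM2026SixVertexGFF, Part II, Lemma 34 (proof, Step 1)] -/
theorem norm_chiDiscr_le_pow (x₁ : ℕ) (y₁ : ℤ) (x₁' : ℕ) (y₁' : ℤ) (x₂ : ℕ) (y₂ : ℤ) {p : ℝ × ℝ}
    (hp0 : 0 ≤ p.1) (hp2 : p.1 ≤ 2) :
    ‖chiDiscr x₁ y₁ x₁' y₁' x₂ y₂ p‖ ≤ 4 * |1 - p.1| ^ x₁' := by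
  have hc : ‖(1 : ℂ) - p.1‖ = |1 - p.1| := by
    rw [← Complex.ofReal_one, ← Complex.ofReal_sub, Complex.norm_real, Real.norm_eq_abs]
  have hc1 : |1 - p.1| ≤ 1 := abs_le.2 ⟨by linarith, by linarith⟩
  have hf : ∀ (n : ℕ) (y : ℤ), ‖((1 : ℂ) - p.1) ^ n * Complex.exp (-(Complex.I * (p.2 : ℂ) * y))‖ ≤ 1 := by
    intro n y
    rw [norm_mul, norm_cexp_neg_I_mul_mul, mul_one, norm_pow, hc]
    exact pow_le_one₀ (abs_nonneg _) hc1
  unfold chiDiscr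
  rw [norm_mul, norm_mul]
  calc _ ≤ 2 * (|1 - p.1| ^ x₁' * 1) * 2 := by
        gcongr
        · exact (norm_sub_le _ _).trans (by rw [norm_one]; linarith [hf x₂ y₂])
        · rw [norm_mul, norm_pow, hc, norm_cexp_neg_I_mul_mul]
        · exact (norm_sub_le _ _).trans (by rw [norm_one]; linarith [hf x₁ y₁])
    _ = 4 * |1 - p.1| ^ x₁' := by ring

/-- **Lemma 34, proof, Step 1 (limit of `N_n`)**: if `μ` gives finite mass to `{1 < a ≤ 2}` and
no mass to `{a = 2}` (for `μ_∞` this is the input from the regularity estimate, Theorem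
(thm:Regularity)), and `x₁'(n) → ∞`, then
`N_n = ∫_{1 < a ≤ 2} χ^discr_{u(n)}(a,b) dμ(a,b) → 0` (dominated convergence with
`|χ^discr| ≤ 4(1-a)^{x₁'} ≤ 4`). [cite: DKLM2026SixVertexGFF, Part II, Lemma 34 (proof, Step 1)] -/
theorem tendsto_setIntegral_chiDiscr_Ioc_zero {μ : Measure (ℝ × ℝ)} (hfin : μ {p : ℝ × ℝ | p.1 ∈ Ioc 1 2} < ⊤)
    (h2 : μ {p : ℝ × ℝ | p.1 = 2} = 0) (kx₁ : ℕ → ℕ) (ky₁ : ℕ → ℤ) {kx₁' : ℕ → ℕ} (hk : Tendsto kx₁' atTop atTop)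
    (ky₁' : ℕ → ℤ) (kx₂ : ℕ → ℕ) (ky₂ : ℕ → ℤ) :
    Tendsto (fun n => ∫ p in {p : ℝ × ℝ | p.1 ∈ Ioc 1 2}, chiDiscr (kx₁ n) (ky₁ n) (kx₁' n) (ky₁' n) (kx₂ n) (ky₂ n) p ∂μ)
      atTop (𝓝 0) := by
  set S : Set (ℝ × ℝ) := {p : ℝ × ℝ | p.1 ∈ Ioc 1 2} with hS
  have hSm : MeasurableSet S := measurableSet_Ioc.preimage measurable_fst
  haveI : IsFiniteMeasure (μ.restrict S) := ⟨by rwa [Measure.restrict_apply_univ]⟩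
  have h0 : (0 : ℂ) = ∫ _ in S, (0 : ℂ) ∂μ := by simp
  rw [h0]
  refine tendsto_integral_filter_of_dominated_convergence (fun _ => (4 : ℝ))
    (Eventually.of_forall fun n => (Continuous.aestronglyMeasurable (by unfold chiDiscr; fun_prop))) ?_
    (integrable_const _) ?_
  · refine Eventually.of_forall fun n => ?_
    rw [ae_restrict_iff' hSm]
    refine ae_of_all _ fun p hp => ?_
    refine (norm_chiDiscr_le_pow _ _ _ _ _ _ (by linarith [hp.1]) hp.2).trans ?_
    have : |1 - p.1| ^ kx₁' n ≤ 1 := pow_le_one₀ (abs_nonneg _) (abs_le.2 ⟨by linarith [hp.2], by linarith [hp.1]⟩)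
    linarith
  · -- a.e. on `S` (off the null set `{a = 2}`), `|1 - a| < 1` and the integrand tends to `0`
    rw [ae_restrict_iff' hSm]
    have hae : ∀ᵐ p ∂μ, p.1 ≠ 2 := by
      rw [ae_iff]
      simpa only [not_not] using h2
    filter_upwards [hae] with p hp2 hp
    have hlt : |1 - p.1| < 1 := abs_lt.2 ⟨by linarith [lt_of_le_of_ne hp.2 hp2], by linarith [hp.1]⟩
    rw [tendsto_zero_iff_norm_tendsto_zero]
    have hpow : Tendsto (fun n => 4 * |1 - p.1| ^ kx₁' n) atTop (𝓝 0) := by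
      rw [← mul_zero (4 : ℝ)]
      exact ((tendsto_pow_atTop_nhds_zero_of_lt_one (abs_nonneg _) hlt).comp hk).const_mul 4
    exact squeeze_zero (fun n => norm_nonneg _) (fun n => norm_chiDiscr_le_pow _ _ _ _ _ _ (by linarith [hp.1]) hp.2) hpow

end Step1

end Literature.Probability.LatticeModels.SixVertex

end
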